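import Summits.HodgeConjecture.CorCM.Census.OcticTwistParity
import Summits.HodgeConjecture.CorCM.Census.OcticTwistResidualPrep

/-!
# The octic twist `(ℤ/8 × B, (4,0))`, XV: THE FLOOR — no family of fewer than `β − 1` vectors generates the octic Hodge lattice modulo
# pairs under the motions (`|B|` odd `≥ 3`), by block parities

COR-CM (cell `pub-hodgecm2`), count-neutral kernel combinatorics by the binder seat b09 (gen 34; lane COINVARIANT-TWIST / OCTIC RECON),
on top of part XVa (`Census/OcticTwistParity.lean`: `parVec₂`, `orbSet₂`, `blkC`, `blkA`, `mk_cst_cst`, `mk_cst_atom`, `mk_atom_cst`,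
`blkC_eq_blkC_iff`, `blkA_eq_blkA_iff`, `blkA_ne_blkC`, `potOrb_blk`, `card_residual_blocks_le_ten`, `parVec₂_mem_span_of_mem`), part IV
(`exists_rel`) and the quartic residual vectors (`QuarticTwistResidual`: `Xvec`, `Wvec`) BY NAME; the pattern is the quartic law
`Census/QuarticTwistLaw.lean` §3 one dimension up.  Theorems only; no definition, no `decide` table, no certificate, no named fact, no `sorry`.
HONEST FRAMING: `HC_CM` is NOT proved, here or anywhere in the tree; nothing here is a period or a headline.

THE FLOOR (**`card_orb₂_le_card_add_one`**, `|B|` odd `≥ 3`).  If a finite family `S` of octic exponent vectors generates the octic Hodge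
lattice together with the octic pairs and all motions — `hodge₂ B ≤ pairs₂ B ⊔ spanMot B S` — then `β(ℤ/8 × B) = #Orb₂ B ≤ |S| + 1`.
PROOF.  The parities of `pairs₂ ⊔ ℤ[G]·S` span at most `|S|` dimensions over `𝔽₂` (part XVa), while `hodge₂` contains `β − 1` vectors with
INDEPENDENT parities (§1–§2): one potential-decreasing face relation per block of potential `≥ 2` (part IV `exists_rel`; unitriangular for the
potential order), and NINE residual vectors — the Weil lifts `w_{s+1} ⊗ e_0` (parity on the blocks `A(s,−)` and `C(−s)`, `|B|` odd), the Boolean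
lifts `X_{t+1,b₀} ⊗ e_0` (parity on `A(t,+)`, `A(t+1,−)`, two `C`ʼs) and one D-move `(e_{−δ_{b₀}} − e_0) ⊗ (e_0 − e_1)` (parity on
`A(3,−), A(2,−), C(0), C(1)`), against the at most ten residual blocks of part XVa.  With part XVI (`exists_faces_generate₂`):
`μ(ℤ/8 × B, (4,0)) = β − 1` EXACTLY inside the pair model.  All [folklore].

## References
* [Pohlmann1968] H. Pohlmann, Algebraic cycles on abelian varieties of complex multiplication type, Ann. of Math. 88 (1968), Thm 1.
* [Milne1999] J. S. Milne, Lefschetz motives and the Tate conjecture, Compositio Math. 117 (1999), Prop. 2.1, p. 54.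
-/

namespace Summit.HodgeConjecture.CorCM.Census.OcticTwist

open Finset
open Summit.HodgeConjecture.CorCM.Census.QuarticTwist

variable (B : Type) [AddGroup B] [Fintype B] [DecidableEq B]

/-! ## §1 The residual vectors and their parities -/

omit [AddGroup B] in
/-- The Boolean pair difference has mass zero. [folklore] -/
theorem sum_Xvec (u : ZMod 4) (b : B) : ∑ s, Xvec B u b s = 0 := by
  unfold Xvec
  simp only [Pi.add_apply, Pi.sub_apply, sum_add_distrib, sum_sub_distrib, Finset.sum_pi_single', mem_univ, if_true]
  ring

omit [AddGroup B] in
/-- The Weil vector has mass zero. [folklore] -/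
theorem sum_Wvec (u : ZMod 4) : ∑ s, Wvec B u s = 0 := by
  unfold Wvec
  simp only [Pi.sub_apply, Pi.smul_apply, Finset.sum_apply, smul_eq_mul, sum_sub_distrib]
  rw [Finset.sum_comm, ← Finset.mul_sum]
  simp only [Finset.sum_pi_single', mem_univ, if_true, Finset.sum_const, Finset.card_univ, nsmul_eq_mul, mul_one]
  ring

/-- **Parity of the Weil lift `w_u ⊗ e_0`** (`|B|` odd): `1` on `A(u − 1, −1)` and on `C(1 − u)`. [folklore] -/
theorem parVec₂_W (hB : Odd (Fintype.card B)) (b₀ : B) (u : ZMod 4) (ω : Orb₂ B) :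
    parVec₂ B (tens B (Wvec B u) (Pi.single (cst B 0) 1)) ω =
      (if ω = blkA B b₀ (u - 1) (-1) then 1 else 0) + (if ω = blkC B (1 - u) then 1 else 0) := by
  have hodd2 : (Fintype.card B : ZMod 2) = 1 := by
    obtain ⟨m, hm⟩ := hB
    rw [hm]; push_cast; rw [show (2 : ZMod 2) = 0 by decide]; ring
  unfold Wvec
  rw [tens_sub_left, tens_sub_left, tens_smul_left, tens_sum_left]
  simp only [← single_eq_tens]
  rw [map_sub, map_sub, map_smul, map_sum, Pi.sub_apply, Pi.sub_apply, Pi.smul_apply, Finset.sum_apply]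
  simp only [parVec₂_single_one, mk_atom_cst B b₀, mk_cst_cst, zero_sub, sub_zero]
  rw [Finset.sum_const, Finset.card_univ, nsmul_eq_mul, hodd2, one_mul, neg_sub]
  -- the even coefficient `|B| − 1` vanishes mod 2
  have hev : (((Fintype.card B : ℤ) - 1) • (if ω = blkC B (-u) then (1 : ZMod 2) else 0)) = 0 := by
    rw [zsmul_eq_mul]; push_cast; rw [hodd2, sub_self, zero_mul]
  rw [hev, sub_zero]
  -- `x − y = x + y` in characteristic two
  have neg2 : ∀ y : ZMod 2, -y = y := by decide
  rw [sub_eq_add_neg, neg2]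

/-- **Parity of the Boolean lift `X_{u,b₀} ⊗ e_0`**: `1` on `A(u − 1, +1)`, `A(u, −1)`, `C(−u)`, `C(−u − 1)`. [folklore] -/
theorem parVec₂_X (b₀ : B) (u : ZMod 4) (ω : Orb₂ B) :
    parVec₂ B (tens B (Xvec B u b₀) (Pi.single (cst B 0) 1)) ω =
      (if ω = blkA B b₀ (u - 1) 1 then 1 else 0) + (if ω = blkA B b₀ u (-1) then 1 else 0)
        + (if ω = blkC B (-u) then 1 else 0) + (if ω = blkC B (-u - 1) then 1 else 0) := by
  unfold Xvec
  rw [tens_sub_left, tens_sub_left, tens_add_left]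
  simp only [← single_eq_tens]
  rw [map_sub, map_sub, map_add, Pi.sub_apply, Pi.sub_apply, Pi.add_apply]
  simp only [parVec₂_single_one, mk_atom_cst B b₀, mk_cst_cst, zero_sub]
  rw [show u + 1 - 0 - 1 = u by ring, show u - 0 - 1 = u - 1 by ring, show -(u + 1) = -u - 1 by ring]
  have neg2 : ∀ y : ZMod 2, -y = y := by decide
  rw [sub_eq_add_neg, neg2, sub_eq_add_neg, neg2]

/-- **Parity of the D-move `(e_{−δ_{b₀}} − e_0) ⊗ (e_0 − e_1)`**: `1` on `A(3, −1)`, `A(2, −1)`, `C(0)`, `C(1)`. [folklore] -/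
theorem parVec₂_D (b₀ : B) (ω : Orb₂ B) :
    parVec₂ B (tens B (Pi.single (atom B 0 b₀ (-1)) 1 - Pi.single (cst B 0) 1) (Pi.single (cst B 0) 1 - Pi.single (cst B 1) 1)) ω =
      (if ω = blkA B b₀ 3 (-1) then 1 else 0) + (if ω = blkA B b₀ 2 (-1) then 1 else 0)
        + (if ω = blkC B 0 then 1 else 0) + (if ω = blkC B 1 then 1 else 0) := by
  rw [tens_sub_sub]
  simp only [← single_eq_tens]
  rw [map_add, map_sub, map_sub, Pi.add_apply, Pi.sub_apply, Pi.sub_apply]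
  simp only [parVec₂_single_one, mk_atom_cst B b₀, mk_cst_cst, sub_zero, sub_self]
  rw [show (0 : ZMod 4) - 1 - 1 = 2 by decide, show (0 : ZMod 4) - 1 = 3 by decide]
  have neg2 : ∀ y : ZMod 2, -y = y := by decide
  rw [sub_eq_add_neg, neg2, sub_eq_add_neg, neg2]
  abel

/-- The parity vector of a potential-decreasing relation through `T`: `1` on the block of `T`, `0` on every other block of potential
`≥ Φ₂(T)`. [folklore] -/
theorem parVec₂_rel {T T₁ T₂ T₃ : Ty₂ B} (h1 : pot B T₁ < pot B T) (h2 : pot B T₂ < pot B T) (h3' : pot B T₃ < pot B T) (ω : Orb₂ B)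
    (hω : pot B T ≤ potOrb B ω) :
    parVec₂ B (Pi.single T 1 - Pi.single T₁ 1 - Pi.single T₂ 1 + Pi.single T₃ 1) ω = if T ∈ orbSet₂ B ω then 1 else 0 := by
  have out : ∀ {T' : Ty₂ B}, pot B T' < pot B T → T' ∉ orbSet₂ B ω := fun hT' hin => by
    have := pot_eq_potOrb_of_mem B hin
    omega
  rw [map_add, map_sub, map_sub, Pi.add_apply, Pi.sub_apply, Pi.sub_apply, parVec₂_single, parVec₂_single, parVec₂_single,
    parVec₂_single, if_neg (out h1), if_neg (out h2), if_neg (out h3'), Int.cast_one]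
  split_ifs <;> ring

omit [AddGroup B] [Fintype B] [DecidableEq B] in
/-- Sums over `ℤ/4`, written out. [folklore] -/
theorem sum_zmod_four {M : Type} [AddCommMonoid M] (f : ZMod 4 → M) : ∑ s, f s = f 0 + f 1 + f 2 + f 3 := Fin.sum_univ_four f

/-! ## §2 The floor -/

/-- **THE FLOOR** (`|B|` odd, `≥ 3`).  If a finite family `S` of octic exponent vectors generates the octic Hodge lattice together with the
octic pairs and all motions, then `β = #Orb₂ B ≤ |S| + 1`. [folklore] -/
theorem card_orb₂_le_card_add_one (hB : Odd (Fintype.card B)) (h3 : 3 ≤ Fintype.card B) (S : Finset (Ty₂ B → ℤ))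
    (hS : hodge₂ B ≤ pairs₂ B ⊔ spanMot B S) : Fintype.card (Orb₂ B) ≤ S.card + 1 := by
  classical
  obtain ⟨b₀⟩ : Nonempty B := Fintype.card_pos_iff.mp (by omega)
  set T := Submodule.span (ZMod 2) ((S.image (parVec₂ B) : Finset _) : Set (Orb₂ B → ZMod 2)) with hT
  have hT' : Module.finrank (ZMod 2) T ≤ S.card := (finrank_span_finset_le_card _).trans Finset.card_image_le
  -- one potential-decreasing relation per block of potential `≥ 2`
  let NRt := {ω : Orb₂ B // 2 ≤ potOrb B ω}
  have hrep : ∀ ω : NRt, 2 ≤ pot B ω.1.out := by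
    intro ω
    have h := ω.2
    rw [← Quotient.out_eq ω.1, potOrb_mk] at h
    exact h
  choose T₁ T₂ T₃ hF hP₁ hP₂ hP₃ using fun ω : NRt => exists_rel B h3 ω.1.out (hrep ω)
  -- the index type and the vectors
  let vec : NRt ⊕ (ZMod 4 ⊕ (ZMod 4 ⊕ Unit)) → (Ty₂ B → ℤ) := fun x =>
    match x with
    | Sum.inl ω => Pi.single ω.1.out 1 - Pi.single (T₁ ω) 1 - Pi.single (T₂ ω) 1 + Pi.single (T₃ ω) 1
    | Sum.inr (Sum.inl s) => tens B (Wvec B (s + 1)) (Pi.single (cst B 0) 1)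
    | Sum.inr (Sum.inr (Sum.inl t)) => tens B (Xvec B (t + 1) b₀) (Pi.single (cst B 0) 1)
    | Sum.inr (Sum.inr (Sum.inr _)) =>
        tens B (Pi.single (atom B 0 b₀ (-1)) 1 - Pi.single (cst B 0) 1) (Pi.single (cst B 0) 1 - Pi.single (cst B 1) 1)
  have hvecH : ∀ x, vec x ∈ hodge₂ B := by
    rintro (ω | s | t | _)
    · exact mem_hodge₂_of_isFace₂ B (hF ω)
    · exact tens_mem_hodge₂_left B (Wvec_mem B _) (sum_Wvec B _) _
    · exact tens_mem_hodge₂_left B (Xvec_mem B _ b₀) (sum_Xvec B _ b₀) _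
    · exact tens_mem_hodge₂_of_sum_eq_zero B (sum_single_sub_single B _ _) (sum_single_sub_single B _ _)
  have hmem : ∀ x, parVec₂ B (vec x) ∈ T := fun x => parVec₂_mem_span_of_mem B S (hS (hvecH x))
  -- parity formulas of the residual vectors
  have vW : ∀ (s : ZMod 4) (ω : Orb₂ B), parVec₂ B (vec (Sum.inr (Sum.inl s))) ω =
      (if ω = blkA B b₀ s (-1) then 1 else 0) + (if ω = blkC B (-s) then 1 else 0) := by
    intro s ω
    show parVec₂ B (tens B (Wvec B (s + 1)) (Pi.single (cst B 0) 1)) ω = _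
    rw [parVec₂_W B hB b₀, add_sub_cancel_right, show 1 - (s + 1) = -s by ring]
  have vX : ∀ (t : ZMod 4) (ω : Orb₂ B), parVec₂ B (vec (Sum.inr (Sum.inr (Sum.inl t)))) ω =
      (if ω = blkA B b₀ t 1 then 1 else 0) + (if ω = blkA B b₀ (t + 1) (-1) then 1 else 0)
        + (if ω = blkC B (-(t + 1)) then 1 else 0) + (if ω = blkC B (-(t + 1) - 1) then 1 else 0) := by
    intro t ω
    show parVec₂ B (tens B (Xvec B (t + 1) b₀) (Pi.single (cst B 0) 1)) ω = _
    rw [parVec₂_X B b₀, add_sub_cancel_right]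
  have vD : ∀ ω : Orb₂ B, parVec₂ B (vec (Sum.inr (Sum.inr (Sum.inr ())))) ω =
      (if ω = blkA B b₀ 3 (-1) then 1 else 0) + (if ω = blkA B b₀ 2 (-1) then 1 else 0)
        + (if ω = blkC B 0 then 1 else 0) + (if ω = blkC B 1 then 1 else 0) := fun ω => parVec₂_D B b₀ ω
  -- residual blocks are not blocks of potential `≥ 2`
  have resA : ∀ (ω : NRt) (ρ k : ZMod 4), (k = 1 ∨ k = -1) → (ω.1 : Orb₂ B) ≠ blkA B b₀ ρ k := by
    intro ω ρ k hk h
    have := (potOrb_blk B h3 b₀ 0 ρ hk).2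
    have h2 := ω.2
    rw [h] at h2
    omega
  have resC : ∀ (ω : NRt) (d : ZMod 4), (ω.1 : Orb₂ B) ≠ blkC B d := by
    intro ω d h
    have := (potOrb_blk B h3 b₀ d 0 (Or.inl rfl)).1
    have h2 := ω.2
    rw [h] at h2
    omega
  have m1 : (-1 : ZMod 4) = 1 ∨ (-1 : ZMod 4) = -1 := Or.inr rfl
  have p1 : (1 : ZMod 4) = 1 ∨ (1 : ZMod 4) = -1 := Or.inl rfl
  -- block (in)equalities at the evaluation points
  have AA : ∀ (ρ ρ' k k' : ZMod 4), k ≠ 0 → (blkA B b₀ ρ k = blkA B b₀ ρ' k' ↔ ρ = ρ' ∧ k = k') :=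
    fun ρ ρ' k k' hk => blkA_eq_blkA_iff B h3 b₀ hk
  have AC : ∀ (ρ k d : ZMod 4), k ≠ 0 → blkA B b₀ ρ k ≠ blkC B d :=
    fun ρ k d hk => blkA_ne_blkC B h3 b₀ ρ hk d
  have k1 : (1 : ZMod 4) ≠ 0 := by decide
  have km : (-1 : ZMod 4) ≠ 0 := by decide
  have CC : ∀ d d' : ZMod 4, blkC B d = blkC B d' ↔ d = d' ∨ d = -d' - 1 := fun d d' => blkC_eq_blkC_iff B d d'
  -- linear independence
  have hli : LinearIndependent (ZMod 2) (fun x => parVec₂ B (vec x)) := by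
    rw [Fintype.linearIndependent_iff]
    intro g hsum
    have heval : ∀ ω : Orb₂ B, (∑ ωn : NRt, g (Sum.inl ωn) * parVec₂ B (vec (Sum.inl ωn)) ω)
        + ((∑ s : ZMod 4, g (Sum.inr (Sum.inl s)) * parVec₂ B (vec (Sum.inr (Sum.inl s))) ω)
          + ((∑ t : ZMod 4, g (Sum.inr (Sum.inr (Sum.inl t))) * parVec₂ B (vec (Sum.inr (Sum.inr (Sum.inl t)))) ω)
            + g (Sum.inr (Sum.inr (Sum.inr ()))) * parVec₂ B (vec (Sum.inr (Sum.inr (Sum.inr ())))) ω)) = 0 := by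
      intro ω
      have h := congrFun hsum ω
      rw [Finset.sum_apply, Fintype.sum_sum_type, Fintype.sum_sum_type, Fintype.sum_sum_type] at h
      simp only [Pi.smul_apply, smul_eq_mul, Pi.zero_apply, Finset.univ_unique, Finset.sum_singleton] at h
      exact h
    -- (a) the non-residual coefficients vanish
    have hnr : ∀ ωn : NRt, g (Sum.inl ωn) = 0 := by
      by_contra hne
      obtain ⟨ω₁, hω₁⟩ := not_forall.mp hne
      obtain ⟨ω₀, hω₀, hmax⟩ := Finset.exists_max_image (univ.filter fun ωn : NRt => g (Sum.inl ωn) ≠ 0)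
        (fun ωn => potOrb B ωn.1) ⟨ω₁, mem_filter.mpr ⟨mem_univ _, hω₁⟩⟩
      have hg₀ : g (Sum.inl ω₀) ≠ 0 := (mem_filter.mp hω₀).2
      have hs₀ : ω₀.1.out ∈ orbSet₂ B ω₀.1 := (mem_orbSet₂ B).mpr (Quotient.out_eq _)
      have h := heval ω₀.1
      rw [vD, if_neg (resA ω₀ 3 (-1) m1), if_neg (resA ω₀ 2 (-1) m1), if_neg (resC ω₀ 0), if_neg (resC ω₀ 1)] at h
      have hWz : ∀ s : ZMod 4, g (Sum.inr (Sum.inl s)) * parVec₂ B (vec (Sum.inr (Sum.inl s))) ω₀.1 = 0 := by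
        intro s
        rw [vW, if_neg (resA ω₀ s (-1) m1), if_neg (resC ω₀ (-s)), add_zero, mul_zero]
      have hXz : ∀ t : ZMod 4, g (Sum.inr (Sum.inr (Sum.inl t))) * parVec₂ B (vec (Sum.inr (Sum.inr (Sum.inl t)))) ω₀.1 = 0 := by
        intro t
        rw [vX, if_neg (resA ω₀ t 1 p1), if_neg (resA ω₀ (t + 1) (-1) m1), if_neg (resC ω₀ _), if_neg (resC ω₀ _), add_zero,
          add_zero, add_zero, mul_zero]
      rw [Finset.sum_eq_zero (fun s _ => hWz s), Finset.sum_eq_zero (fun t _ => hXz t)] at h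
      have hterm : ∀ ωn : NRt, g (Sum.inl ωn) * parVec₂ B (vec (Sum.inl ωn)) ω₀.1 = if ωn = ω₀ then g (Sum.inl ω₀) else 0 := by
        intro ωn
        by_cases hgn : g (Sum.inl ωn) = 0
        · rw [hgn, zero_mul]; split_ifs with h' <;> [rw [← h', hgn]; rfl]
        · have hle : potOrb B ωn.1 ≤ potOrb B ω₀.1 := hmax ωn (mem_filter.mpr ⟨mem_univ _, hgn⟩)
          have hpot : pot B ωn.1.out ≤ potOrb B ω₀.1 := by rw [← Quotient.out_eq ωn.1, potOrb_mk] at hle; exact hle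
          rw [show vec (Sum.inl ωn) = Pi.single ωn.1.out 1 - Pi.single (T₁ ωn) 1 - Pi.single (T₂ ωn) 1 + Pi.single (T₃ ωn) 1
              from rfl, parVec₂_rel B (hP₁ ωn) (hP₂ ωn) (hP₃ ωn) ω₀.1 hpot]
          by_cases hωω : ωn = ω₀
          · subst hωω; rw [if_pos hs₀, if_pos rfl, mul_one]
          · have hnot : ωn.1.out ∉ orbSet₂ B ω₀.1 := by
              intro hin
              exact hωω (Subtype.ext (((mem_orbSet₂ B).mp hin).symm ▸ (Quotient.out_eq ωn.1).symm ▸ rfl))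
            rw [if_neg hnot, if_neg hωω, mul_zero]
      rw [Finset.sum_congr rfl (fun ωn _ => hterm ωn), Finset.sum_ite_eq' univ ω₀, if_pos (mem_univ _)] at h
      simp only [mul_zero, add_zero] at h
      exact hg₀ h
    have hrest : ∀ ω : Orb₂ B, (∑ s : ZMod 4, g (Sum.inr (Sum.inl s)) * parVec₂ B (vec (Sum.inr (Sum.inl s))) ω)
        + ((∑ t : ZMod 4, g (Sum.inr (Sum.inr (Sum.inl t))) * parVec₂ B (vec (Sum.inr (Sum.inr (Sum.inl t)))) ω)
          + g (Sum.inr (Sum.inr (Sum.inr ()))) * parVec₂ B (vec (Sum.inr (Sum.inr (Sum.inr ())))) ω) = 0 := by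
      intro ω
      have h := heval ω
      rw [Finset.sum_eq_zero (fun ωn _ => by rw [hnr ωn, zero_mul]), zero_add] at h
      exact h
    -- (b) the Boolean lifts: evaluate at `A(ρ, +1)`
    have hX : ∀ t : ZMod 4, g (Sum.inr (Sum.inr (Sum.inl t))) = 0 := by
      intro ρ
      have h := hrest (blkA B b₀ ρ 1)
      have hWz : ∀ s : ZMod 4, g (Sum.inr (Sum.inl s)) * parVec₂ B (vec (Sum.inr (Sum.inl s))) (blkA B b₀ ρ 1) = 0 := by
        intro s
        rw [vW, if_neg (show ¬ blkA B b₀ ρ 1 = blkA B b₀ s (-1) from fun h' => absurd ((AA _ _ _ _ k1).mp h').2 (by decide)),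
          if_neg (AC ρ 1 (-s) k1), add_zero, mul_zero]
      have hXt : ∀ t : ZMod 4, g (Sum.inr (Sum.inr (Sum.inl t))) * parVec₂ B (vec (Sum.inr (Sum.inr (Sum.inl t)))) (blkA B b₀ ρ 1)
          = if ρ = t then g (Sum.inr (Sum.inr (Sum.inl t))) else 0 := by
        intro t
        rw [vX, if_neg (AC ρ 1 (-(t + 1)) k1), if_neg (AC ρ 1 (-(t + 1) - 1) k1), add_zero, add_zero,
          if_neg (show ¬ blkA B b₀ ρ 1 = blkA B b₀ (t + 1) (-1) from fun h' => absurd ((AA _ _ _ _ k1).mp h').2 (by decide)),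
          add_zero]
        by_cases hρt : ρ = t
        · rw [if_pos ((AA _ _ _ _ k1).mpr ⟨hρt, rfl⟩), if_pos hρt, mul_one]
        · rw [if_neg (fun h' => hρt ((AA _ _ _ _ k1).mp h').1), if_neg hρt, mul_zero]
      have hDz : g (Sum.inr (Sum.inr (Sum.inr ()))) * parVec₂ B (vec (Sum.inr (Sum.inr (Sum.inr ())))) (blkA B b₀ ρ 1) = 0 := by
        rw [vD, if_neg (show ¬ blkA B b₀ ρ 1 = blkA B b₀ 3 (-1) from fun h' => absurd ((AA _ _ _ _ k1).mp h').2 (by decide)),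
          if_neg (show ¬ blkA B b₀ ρ 1 = blkA B b₀ 2 (-1) from fun h' => absurd ((AA _ _ _ _ k1).mp h').2 (by decide)),
          if_neg (AC ρ 1 0 k1), if_neg (AC ρ 1 1 k1), add_zero, add_zero, add_zero, mul_zero]
      rw [Finset.sum_eq_zero (fun s _ => hWz s), zero_add, Finset.sum_congr rfl (fun t _ => hXt t), Finset.sum_ite_eq univ ρ,
        if_pos (mem_univ _), hDz, add_zero] at h
      exact h
    have hrest' : ∀ ω : Orb₂ B, (∑ s : ZMod 4, g (Sum.inr (Sum.inl s)) * parVec₂ B (vec (Sum.inr (Sum.inl s))) ω)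
        + g (Sum.inr (Sum.inr (Sum.inr ()))) * parVec₂ B (vec (Sum.inr (Sum.inr (Sum.inr ())))) ω = 0 := by
      intro ω
      have h := hrest ω
      have hXz : ∑ t : ZMod 4, g (Sum.inr (Sum.inr (Sum.inl t))) * parVec₂ B (vec (Sum.inr (Sum.inr (Sum.inl t)))) ω = 0 :=
        Finset.sum_eq_zero (fun t _ => by rw [hX t, zero_mul])
      rw [hXz, zero_add] at h
      exact h
    -- (c) the Weil lifts and the D-move: evaluate at `A(ρ, −1)` and at `C(0)`
    have hWA : ∀ ρ : ZMod 4, g (Sum.inr (Sum.inl ρ)) + g (Sum.inr (Sum.inr (Sum.inr ())))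
        * ((if blkA B b₀ ρ (-1) = blkA B b₀ 3 (-1) then 1 else 0) + (if blkA B b₀ ρ (-1) = blkA B b₀ 2 (-1) then 1 else 0)) = 0 := by
      intro ρ
      have h := hrest' (blkA B b₀ ρ (-1))
      have hWs : ∀ s : ZMod 4, g (Sum.inr (Sum.inl s)) * parVec₂ B (vec (Sum.inr (Sum.inl s))) (blkA B b₀ ρ (-1))
          = if ρ = s then g (Sum.inr (Sum.inl s)) else 0 := by
        intro s
        rw [vW, if_neg (AC ρ (-1) (-s) km), add_zero]
        by_cases hρs : ρ = s
        · rw [if_pos ((AA _ _ _ _ km).mpr ⟨hρs, rfl⟩), if_pos hρs, mul_one]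
        · rw [if_neg (fun h' => hρs ((AA _ _ _ _ km).mp h').1), if_neg hρs, mul_zero]
      rw [Finset.sum_congr rfl (fun s _ => hWs s), Finset.sum_ite_eq univ ρ, if_pos (mem_univ _), vD,
        if_neg (AC ρ (-1) 0 km), if_neg (AC ρ (-1) 1 km), add_zero, add_zero] at h
      exact h
    have eW0 : g (Sum.inr (Sum.inl 0)) = 0 := by
      have h := hWA 0
      rw [if_neg (show ¬ blkA B b₀ 0 (-1) = blkA B b₀ 3 (-1) from fun h' => absurd ((AA _ _ _ _ km).mp h').1 (by decide)),
        if_neg (show ¬ blkA B b₀ 0 (-1) = blkA B b₀ 2 (-1) from fun h' => absurd ((AA _ _ _ _ km).mp h').1 (by decide)),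
        add_zero, mul_zero, add_zero] at h
      exact h
    have eW1 : g (Sum.inr (Sum.inl 1)) = 0 := by
      have h := hWA 1
      rw [if_neg (show ¬ blkA B b₀ 1 (-1) = blkA B b₀ 3 (-1) from fun h' => absurd ((AA _ _ _ _ km).mp h').1 (by decide)),
        if_neg (show ¬ blkA B b₀ 1 (-1) = blkA B b₀ 2 (-1) from fun h' => absurd ((AA _ _ _ _ km).mp h').1 (by decide)),
        add_zero, mul_zero, add_zero] at h
      exact h
    have eD : g (Sum.inr (Sum.inr (Sum.inr ()))) = 0 := by
      have h := hrest' (blkC B 0)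
      rw [sum_zmod_four, vW, vW, vW, vW, vD] at h
      have nCA : ∀ ρ : ZMod 4, ¬ blkC B 0 = blkA B b₀ ρ (-1) := fun ρ h' => AC ρ (-1) 0 km h'.symm
      have yC0 : blkC B 0 = blkC B (-0) := by rw [neg_zero]
      have yC3 : blkC B 0 = blkC B (-1) := (CC 0 (-1)).mpr (Or.inr (by decide))
      have nC2 : ¬ blkC B 0 = blkC B (-2) := fun h' => absurd ((CC 0 (-2)).mp h') (by decide)
      have nC3 : ¬ blkC B 0 = blkC B (-3) := fun h' => absurd ((CC 0 (-3)).mp h') (by decide)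
      have nC1 : ¬ blkC B 0 = blkC B 1 := fun h' => absurd ((CC 0 1).mp h') (by decide)
      rw [if_neg (nCA 0), if_neg (nCA 1), if_neg (nCA 2), if_neg (nCA 3), if_pos yC0, if_pos yC3, if_neg nC2, if_neg nC3,
        if_pos rfl, if_neg nC1, eW0, eW1] at h
      simpa using h
    have eW : ∀ s : ZMod 4, g (Sum.inr (Sum.inl s)) = 0 := by
      intro ρ
      have h := hWA ρ
      rw [eD, zero_mul, add_zero] at h
      exact h
    rintro (ω | s | t | u)
    · exact hnr ω
    · exact eW s
    · exact hX t
    · cases u; exact eD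
  -- count
  have hli' : LinearIndependent (ZMod 2) (fun x => (⟨_, hmem x⟩ : T)) := LinearIndependent.of_comp T.subtype hli
  have hcard := hli'.fintype_card_le_finrank
  simp only [Fintype.card_sum, ZMod.card, Fintype.card_unique] at hcard
  have hsplit : Fintype.card NRt + Fintype.card {ω : Orb₂ B // potOrb B ω ≤ 1} = Fintype.card (Orb₂ B) := by
    have h1 : Fintype.card NRt = Fintype.card {ω : Orb₂ B // ¬ potOrb B ω ≤ 1} :=
      Fintype.card_congr (Equiv.subtypeEquivRight fun ω => by omega)
    rw [h1, Fintype.card_subtype_compl, Nat.sub_add_cancel (Fintype.card_subtype_le _)]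
  have hten := card_residual_blocks_le_ten B h3
  omega

end Summit.HodgeConjecture.CorCM.Census.OcticTwist
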